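import Literature.AlgebraicGeometry.Resolution.NearPointsLocus
import Mathlib.RingTheory.Length
import HarnessLib

/-!
# Off the centre the colength of the weak transform is unchanged (CoP1, Prop. 4.4 bookkeeping)

Topic: `Literature/AlgebraicGeometry/Resolution`. Companion to `NearPointColengthDropScheme.lean`
for the termination argument of Cossart–Piltant, J. Algebra 320 (2008), proof of Prop. 4.4, p. 10
("`n(i+1) ≤ n(i)` … hence `n(i)` eventually drops"): at a point `x′` of a blowing up `π` along
`C` whose image is OFF the centre, `π` is a local isomorphism and the weak transform is the
extended ideal, so the colength is unchanged: `λ(𝒪_{X′,x′}/J′_{x′}) = λ(𝒪_{X,π x′}/J_{π x′})`.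
Hence the natural number `λ(𝒪_{X(i),η(i)}/J(i)_{η(i)})` attached to a chain of curves of the
loci `Σ(i)` is non-increasing, and drops whenever the curve itself is blown up
(`NearPointColengthDropScheme.lean`). PROVED:

* `length_quotient_map_eq_of_ringEquiv` — `λ_S(S/ε(I)) = λ_R(R/I)` for a ring isomorphism
  `ε : R ≃ S`;
* `IsBlowup.length_quotient_stalkIdeal_controlledTransform_eq_of_not_mem_support` — **the
  statement above.**

## Sources

* V. Cossart, O. Piltant, J. Algebra 320 (2008) 1051–1082, proof of Prop. 4.4, p. 10.
  [CossartPiltant2008]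
-/

noncomputable section

open CategoryTheory CategoryTheory.Limits AlgebraicGeometry TopologicalSpace IsLocalRing

namespace Literature.AlgebraicGeometry.Resolution

universe u

open Scheme.IdealSheafData

/-! ## Lengths along a ring isomorphism -/

/-- **`λ_S(S/ε(I)) = λ_R(R/I)` for a ring isomorphism `ε : R ≃ S`**: through `ε`, `S/ε(I)` is
`R/I`. [folklore] -/
theorem length_quotient_map_eq_of_ringEquiv {R S : Type*} [CommRing R] [CommRing S]
    (ε : R ≃+* S) (I : Ideal R) :
    Module.length S (S ⧸ I.map (ε : R →+* S)) = Module.length R (R ⧸ I) := by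
  -- the ring isomorphism `R/I ≅ S/ε(I)`
  have e : R ⧸ I ≃+* S ⧸ I.map (ε : R →+* S) := Ideal.quotientEquiv I _ ε rfl
  -- lengths of a ring over itself are invariant under ring isomorphisms
  have h1 : Module.length (S ⧸ I.map (ε : R →+* S)) (S ⧸ I.map (ε : R →+* S)) =
      Module.length (R ⧸ I) (R ⧸ I) := by
    letI := e.toRingHom.toAlgebra
    have hs : Function.Surjective (algebraMap (R ⧸ I) (S ⧸ I.map (ε : R →+* S))) := e.surjective
    rw [← Module.length_eq_of_surjective (S := R ⧸ I) (R := S ⧸ I.map (ε : R →+* S)) hs]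
    -- as an `R/I`-module, `S/ε(I)` is isomorphic to `R/I` via `e`
    let f : (R ⧸ I) ≃ₗ[R ⧸ I] (S ⧸ I.map (ε : R →+* S)) :=
      { e with
        map_smul' := fun r x => by
          change e (r * x) = algebraMap (R ⧸ I) _ r * e x
          rw [map_mul]
          rfl }
    exact f.length_eq.symm
  rw [← Module.length_eq_of_surjective (S := S) (R := S ⧸ I.map (ε : R →+* S))
      Ideal.Quotient.mk_surjective,
    ← Module.length_eq_of_surjective (S := R) (R := R ⧸ I) Ideal.Quotient.mk_surjective] at h1
  exact h1

/-! ## Off the centre -/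

variable {X X' : Scheme.{u}} {π : X' ⟶ X}

/-- **Off the centre the colength of the weak transform is that of `J`**: for a blowing up
`π` along `C` and `π x′ ∉ V(C)`, `𝒪_{X,π x′} ≅ 𝒪_{X′,x′}` and `J′_{x′} = J_{π x′}𝒪_{X′,x′}`, so
`λ(𝒪_{X′,x′}/J′_{x′}) = λ(𝒪_{X,π x′}/J_{π x′})`. [cite: CossartPiltant2008, proof of Prop. 4.4] -/
theorem IsBlowup.length_quotient_stalkIdeal_controlledTransform_eq_of_not_mem_support
    [IsLocallyNoetherian X'] {C : X.IdealSheafData} (hπ : IsBlowup π C) (J : X.IdealSheafData)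
    (μ : ℕ) {x' : X'} (hxC : π x' ∉ C.support) :
    Module.length (X'.presheaf.stalk x')
        (X'.presheaf.stalk x' ⧸ stalkIdeal (controlledTransform π C J μ) x') =
      Module.length (X.presheaf.stalk (π x')) (X.presheaf.stalk (π x') ⧸ stalkIdeal J (π x')) := by
  haveI := hπ.isIso_stalkMap_of_not_mem_support hxC
  let ε : X.presheaf.stalk (π x') ≃+* X'.presheaf.stalk x' :=
    (asIso (π.stalkMap x')).commRingCatIsoToRingEquiv
  have hε : (ε : X.presheaf.stalk (π x') →+* X'.presheaf.stalk x') = (π.stalkMap x').hom := rfl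
  rw [stalkIdeal_controlledTransform_of_not_mem_support J μ hxC, ← hε]
  exact length_quotient_map_eq_of_ringEquiv ε _

end Literature.AlgebraicGeometry.Resolution

end
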